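import Summits.Ventures.PercRepro.StarGadgetGraphTables
import Summits.Ventures.PercRepro.StarGadgetGraphCert
import Summits.Ventures.PercRepro.HWalkCentral
import Summits.Ventures.PercRepro.ReachFromRel
import Summits.Ventures.PercRepro.FibreProductCount

/-!
# The star gadget — reachability and counting (graph half, modules 4 + 5b in one file)

PART A (reachability): by the contraction lemma (`hConnAvoid_iff_relC`, module `HWalkCentral`) an
H-walk between two centrals avoiding `X` is a walk of contracted steps `RelC` on the centrals; each
contracted step is a direct H-step (the table `T2`) or a detour through ONE hub (an existential fact
about the hubs' types and states, `Hf`).  So, once the detour facts of the live pairs are given by a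
Boolean matrix `d`, H-connectivity is `reach4` of the matrix `cellMat cx β μ X d`
(`hConnAvoid_cen_iff_reach4`) — a statement `decide` can evaluate for every assignment of the facts.

PART B (counting): a **hub configuration** `σ : HubConfig p q r s` is the restriction of a
configuration of the gadget to the hub edges; a CELL is a mode `μ`, an avoided set `X`, two centrals
`src dst` and a FACT FAMILY encoded by `pairs : Fin k → Option (Fin 4 × Fin 4)` — `some (i, j)` is
the detour fact of the pair `(i, j)` (`Dpred`), `none` the mode witness (`Wpred`).  The weight `Wfun`
of a fact vector is the indicator of «the witness facts hold and `src` reaches `dst` in `cellMat`».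
`cell_eq` counts `∑ σ allowed, Wfun (facts σ)` as an explicit exponential polynomial in `p q r s`
from a coefficient list `L` of entries `(m, U, a, b, c, d)`: the CERTIFICATE `hcert` (the list
reproduces `Wfun` on every fact vector, `sum_weight_eq_of_cert`) and the BASES `hbase` (the per-type
counts of allowed states avoiding the facts of `U` are `a b c d`) — both finite statements for
`decide`.  The counts are products because the facts are existential over the independent hubs
(`card_filter_fibres_eq_prod`).
-/

namespace PercRepro

/-- **Lifting a closure along an injection.**  If every related pair lies in the range of an
injective `f`, the reflexive–transitive closure between points of the range is the closure of the
pulled-back relation. -/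
theorem reflTransGen_comap_iff {α β : Type*} (f : α → β) (hf : Function.Injective f)
    (r : β → β → Prop) (hr : ∀ x y, r x y → x ∈ Set.range f ∧ y ∈ Set.range f) (i j : α) :
    Relation.ReflTransGen r (f i) (f j) ↔
      Relation.ReflTransGen (fun i j => r (f i) (f j)) i j := by
  constructor
  · intro h
    have key : ∀ {w}, Relation.ReflTransGen r (f i) w →
        ∃ j', w = f j' ∧ Relation.ReflTransGen (fun i j => r (f i) (f j)) i j' := by
      intro w hw
      induction hw with
      | refl => exact ⟨i, rfl, Relation.ReflTransGen.refl⟩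
      | tail _ hxy ih =>
        obtain ⟨j', rfl, hj'⟩ := ih
        obtain ⟨-, ⟨j'', rfl⟩⟩ := hr _ _ hxy
        exact ⟨j'', rfl, hj'.tail hxy⟩
    obtain ⟨j', hj, hR⟩ := key h
    obtain rfl := hf hj
    exact hR
  · intro h
    exact h.lift f (fun _ _ hxy => hxy)

namespace StarGadgetGraph

open MultiGraph

variable {cx : Bool} {p q r s : ℕ}

/-- **A contracted step between two distinct centrals is an entry of `cellMat`**, given the detour
facts `d` of the live pairs (both centrals avoid `X`, no direct H-step). -/
theorem relC_cen_iff {μ : Mode} {ω : Config (E cx p q r s)} (hμ : InMode μ ω) {β : Bool}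
    (hβ : cxOpen ω ↔ β = true) (X : Option (Fin 3)) (d : Fin 4 → Fin 4 → Bool)
    (hd : ∀ i j, i ≠ j → nx X μ i = true → nx X μ j = true → T2 cx β μ i j = false →
      ((∃ h, ¬ inX μ X (hubType h) (hubState ω h) ∧ Hf μ i (hubType h) (hubState ω h) ∧
        Hf μ j (hubType h) (hubState ω h)) ↔ d i j = true))
    (i j : Fin 4) (hij : i ≠ j) :
    (starGadget cx p q r s).RelC ω (vm 2) (Cen p q r s) (Xset ω X) (cen i) (cen j) ↔
      cellMat cx β μ X d i j = true := by
  unfold RelC cellMat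
  simp only [cen_mem_cen, true_and, cen_not_mem_Xset_iff hμ, hadj_cen_cen_iff hμ hβ i j hij,
    Bool.and_eq_true, Bool.or_eq_true]
  -- the detour through a hub
  have hD : (∃ h, h ∉ Cen p q r s ∧ h ∉ Xset ω X ∧
      (starGadget cx p q r s).HAdj ω (vm 2) (cen i) h ∧
        (starGadget cx p q r s).HAdj ω (vm 2) h (cen j)) ↔
      ∃ h, ¬ inX μ X (hubType h) (hubState ω h) ∧ Hf μ i (hubType h) (hubState ω h) ∧
        Hf μ j (hubType h) (hubState ω h) := by
    constructor
    · rintro ⟨v, hvC, hvX, h1, h2⟩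
      rcases eq_cen_or_eq_inr v with ⟨k, rfl⟩ | ⟨h, rfl⟩
      · exact absurd (cen_mem_cen k) hvC
      · refine ⟨h, (inr_not_mem_Xset_iff hμ X h).1 hvX, (hadj_cen_inr_iff hμ i h).1 h1, ?_⟩
        exact (hadj_cen_inr_iff hμ j h).1 h2.symm
    · rintro ⟨h, hX, h1, h2⟩
      exact ⟨Sum.inr h, inr_not_mem_cen h, (inr_not_mem_Xset_iff hμ X h).2 hX,
        (hadj_cen_inr_iff hμ i h).2 h1, ((hadj_cen_inr_iff hμ j h).2 h2).symm⟩
  rw [hD]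
  by_cases hi : nx X μ i = true
  · by_cases hj : nx X μ j = true
    · simp only [hi, hj, true_and]
      by_cases hT : T2 cx β μ i j = true
      · simp [hT]
      · have hT' : T2 cx β μ i j = false := by simpa using hT
        rw [hd i j hij hi hj hT']
    · simp [hj]
  · simp [hi]

/-- **H-connectivity between centrals is `reach4` of `cellMat`.** -/
theorem hConnAvoid_cen_iff_reach4 {μ : Mode} {ω : Config (E cx p q r s)} (hμ : InMode μ ω)
    {β : Bool} (hβ : cxOpen ω ↔ β = true) (X : Option (Fin 3)) (d : Fin 4 → Fin 4 → Bool)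
    (hd : ∀ i j, i ≠ j → nx X μ i = true → nx X μ j = true → T2 cx β μ i j = false →
      ((∃ h, ¬ inX μ X (hubType h) (hubState ω h) ∧ Hf μ i (hubType h) (hubState ω h) ∧
        Hf μ j (hubType h) (hubState ω h)) ↔ d i j = true))
    (i j : Fin 4) :
    (starGadget cx p q r s).HConnAvoid ω (vm 2) (Xset ω X) (cen i) (cen j) ↔
      reach4 (cellMat cx β μ X d) i j := by
  rw [(starGadget cx p q r s).hConnAvoid_iff_relC ω (vm 2) (Cen p q r s) (Xset ω X)
    fst_mem_cen_or_snd_mem_cen (xset_closed ω X) (cen_mem_cen i) (cen_mem_cen j)]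
  rw [reflTransGen_comap_iff cen cen_injective _ (fun x y hxy => ⟨hxy.1, hxy.2.1⟩)]
  rw [reflTransGen_iff_reachable_fromRel (fun _ _ hxy => RelC.symm hxy)]
  unfold reach4
  have hG : SimpleGraph.fromRel (fun i j : Fin 4 =>
      (starGadget cx p q r s).RelC ω (vm 2) (Cen p q r s) (Xset ω X) (cen i) (cen j)) =
      SimpleGraph.fromRel fun i j => cellMat cx β μ X d i j = true := by
    ext i j
    simp only [SimpleGraph.fromRel_adj]
    constructor
    · rintro ⟨hij, h | h⟩
      · exact ⟨hij, Or.inl ((relC_cen_iff hμ hβ X d hd i j hij).1 h)⟩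
      · exact ⟨hij, Or.inr ((relC_cen_iff hμ hβ X d hd j i (Ne.symm hij)).1 h)⟩
    · rintro ⟨hij, h | h⟩
      · exact ⟨hij, Or.inl ((relC_cen_iff hμ hβ X d hd i j hij).2 h)⟩
      · exact ⟨hij, Or.inr ((relC_cen_iff hμ hβ X d hd j i (Ne.symm hij)).2 h)⟩
  rw [hG]

end StarGadgetGraph

end PercRepro

namespace PercRepro.StarGadgetGraph

open Finset

variable {p q r s : ℕ}

/-- The hub configurations: the states of all hub edges. -/
abbrev HubConfig (p q r s : ℕ) := (Σ h : Hub p q r s, HubEdge (hubType h)) → Bool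

/-- A configuration of the gadget from the state `g` of the optional edge `c – x` and a hub
configuration. -/
def mk {cx : Bool} (g : Fin (if cx then 1 else 0) → Bool) (σ : HubConfig p q r s) :
    Config (E cx p q r s) :=
  Sum.elim g σ

/-- The hub states of `mk g σ` are the fibre states of `σ`. -/
theorem hubState_mk {cx : Bool} (g : Fin (if cx then 1 else 0) → Bool) (σ : HubConfig p q r s)
    (h : Hub p q r s) : hubState (mk g σ) h = fibreState σ h := rfl

/-- The bit of the edge `c – x`: open iff `g` is `true` somewhere (never, when the edge is absent). -/
def cxbit {n : ℕ} (g : Fin n → Bool) : Bool := decide (∃ i, g i = true)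

/-- `cxOpen` of `mk g σ` is the bit `cxbit g`. -/
theorem cxOpen_mk_iff {cx : Bool} (g : Fin (if cx then 1 else 0) → Bool) (σ : HubConfig p q r s) :
    cxOpen (mk g σ) ↔ cxbit g = true := by
  unfold cxOpen cxbit mk
  simp

/-- A predicate on hub states (of every type). -/
abbrev StatePred := ∀ T : HubType, (HubEdge T → Bool) → Prop

/-- All hubs of `σ` are in states allowed in mode `μ`. -/
def allowed (μ : Mode) (σ : HubConfig p q r s) : Prop := ∀ h, inA μ (hubType h) (fibreState σ h)

/-- `allowed` is decidable. -/
instance (μ : Mode) (σ : HubConfig p q r s) : Decidable (allowed μ σ) := by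
  unfold allowed; infer_instance

/-- The detour predicate of the pair `(i, j)`: the hub avoids `X` and is H-adjacent to both. -/
def Dpred (μ : Mode) (X : Option (Fin 3)) (i j : Fin 4) (T : HubType) (s : HubEdge T → Bool) :
    Prop :=
  ¬ inX μ X T s ∧ Hf μ i T s ∧ Hf μ j T s

/-- The witness predicate of the mode: open `x`-edge and open edge to the mode's mark. -/
def Wpred (μ : Mode) (T : HubType) (s : HubEdge T → Bool) : Prop :=
  xo s ∧ ∃ m, μ = some m ∧ mo s m

/-- `Dpred` is decidable. -/
instance (μ : Mode) (X : Option (Fin 3)) (i j : Fin 4) (T : HubType) (s : HubEdge T → Bool) :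
    Decidable (Dpred μ X i j T s) := by
  unfold Dpred; infer_instance

/-- `Wpred` is decidable. -/
instance (μ : Mode) (T : HubType) (s : HubEdge T → Bool) : Decidable (Wpred μ T s) := by
  unfold Wpred; infer_instance

/-- The fact family of a cell: the detour predicate of the pair, or the witness. -/
def famPred {k : ℕ} (μ : Mode) (X : Option (Fin 3)) (pairs : Fin k → Option (Fin 4 × Fin 4))
    (l : Fin k) (T : HubType) (s : HubEdge T → Bool) : Prop :=
  match pairs l with
  | some ij => Dpred μ X ij.1 ij.2 T s
  | none => Wpred μ T s

/-- `famPred` is decidable. -/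
instance {k : ℕ} (μ : Mode) (X : Option (Fin 3)) (pairs : Fin k → Option (Fin 4 × Fin 4))
    (l : Fin k) (T : HubType) (s : HubEdge T → Bool) : Decidable (famPred μ X pairs l T s) := by
  unfold famPred
  split <;> infer_instance

/-- An existential fact about the hubs: some hub is in a state satisfying `Q`. -/
def factOf (Q : StatePred) (σ : HubConfig p q r s) : Prop := ∃ h, Q (hubType h) (fibreState σ h)

/-- `factOf` is decidable for decidable `Q`. -/
instance (Q : StatePred) [∀ T s, Decidable (Q T s)] (σ : HubConfig p q r s) :
    Decidable (factOf Q σ) := by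
  unfold factOf; infer_instance

/-- The fact vector of a hub configuration. -/
def tvec {k : ℕ} (μ : Mode) (X : Option (Fin 3)) (pairs : Fin k → Option (Fin 4 × Fin 4))
    (σ : HubConfig p q r s) : Fin k → Bool :=
  fun l => decide (factOf (famPred μ X pairs l) σ)

/-- The detour matrix read off a fact vector. -/
def dmat {k : ℕ} (pairs : Fin k → Option (Fin 4 × Fin 4)) (t : Fin k → Bool) (i j : Fin 4) :
    Bool :=
  decide (∃ l, (pairs l = some (i, j) ∨ pairs l = some (j, i)) ∧ t l = true)

/-- The family carries a witness fact. -/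
def hasW {k : ℕ} (pairs : Fin k → Option (Fin 4 × Fin 4)) : Prop := ∃ l, pairs l = none

/-- `hasW` is decidable. -/
instance {k : ℕ} (pairs : Fin k → Option (Fin 4 × Fin 4)) : Decidable (hasW pairs) := by
  unfold hasW; infer_instance

/-- The witness facts of a fact vector hold. -/
def wcond {k : ℕ} (pairs : Fin k → Option (Fin 4 × Fin 4)) (t : Fin k → Bool) : Prop :=
  ∀ l, pairs l = none → t l = true

/-- `wcond` is decidable. -/
instance {k : ℕ} (pairs : Fin k → Option (Fin 4 × Fin 4)) (t : Fin k → Bool) :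
    Decidable (wcond pairs t) := by
  unfold wcond; infer_instance

/-- The weight of a fact vector: the witness facts hold and `src` reaches `dst`. -/
def Wfun {k : ℕ} (cx β : Bool) (μ : Mode) (X : Option (Fin 3))
    (pairs : Fin k → Option (Fin 4 × Fin 4)) (src dst : Fin 4) (t : Fin k → Bool) : ℤ :=
  if wcond pairs t ∧ reach4 (cellMat cx β μ X (dmat pairs t)) src dst then 1 else 0

/-- The number of allowed states of the type `T` avoiding the facts of `U`. -/
def cT {k : ℕ} (μ : Mode) (X : Option (Fin 3)) (pairs : Fin k → Option (Fin 4 × Fin 4))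
    (U : Finset (Fin k)) (T : HubType) : ℕ :=
  (univ.filter fun s : HubEdge T → Bool => inA μ T s ∧ ∀ l ∈ U, ¬ famPred μ X pairs l T s).card

/-- **The product count**: the allowed configurations in which no fact of `U` holds are counted by
the product of the per-type counts. -/
theorem card_allowed_not_facts {k : ℕ} (μ : Mode) (X : Option (Fin 3))
    (pairs : Fin k → Option (Fin 4 × Fin 4)) (U : Finset (Fin k)) :
    (univ.filter fun σ : HubConfig p q r s =>
      allowed μ σ ∧ ∀ l ∈ U, ¬ factOf (famPred μ X pairs l) σ).card =
      cT μ X pairs U .ab ^ p * cT μ X pairs U .ac ^ q * cT μ X pairs U .bc ^ r *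
        cT μ X pairs U .abc ^ s := by
  have h1 : (univ.filter fun σ : HubConfig p q r s =>
      allowed μ σ ∧ ∀ l ∈ U, ¬ factOf (famPred μ X pairs l) σ) =
      univ.filter fun σ : HubConfig p q r s => ∀ h, fibreState σ h ∈
        (univ.filter fun s' : HubEdge (hubType h) → Bool =>
          inA μ (hubType h) s' ∧ ∀ l ∈ U, ¬ famPred μ X pairs l (hubType h) s') := by
    ext σ
    simp only [mem_filter, mem_univ, true_and, allowed, factOf, not_exists]
    constructor
    · rintro ⟨hA, hF⟩ h
      exact ⟨hA h, fun l hl => hF l hl h⟩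
    · intro H
      exact ⟨fun h => (H h).1, fun l hl h => (H h).2 l hl⟩
  rw [h1, card_filter_fibres_eq_prod]
  have h2 : (fun h : Hub p q r s => (univ.filter fun s' : HubEdge (hubType h) → Bool =>
      inA μ (hubType h) s' ∧ ∀ l ∈ U, ¬ famPred μ X pairs l (hubType h) s').card) =
      Sum.elim (fun _ => cT μ X pairs U .ab) (Sum.elim (fun _ => cT μ X pairs U .ac)
        (Sum.elim (fun _ => cT μ X pairs U .bc) (fun _ => cT μ X pairs U .abc))) := by
    funext h
    rcases h with _ | _ | _ | _ <;> rfl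
  rw [h2, prod_sum_elim_const_four]

/-- **The cell theorem.**  Given a coefficient list `L` of entries `(m, U, a, b, c, d)` that
reproduces the weight on every fact vector (`hcert`) and whose bases are the per-type counts
(`hbase`), the weighted count of the allowed configurations is the explicit exponential polynomial
`∑ m · a^p b^q c^r d^s`. -/
theorem cell_eq {k : ℕ} (cx β : Bool) (μ : Mode) (X : Option (Fin 3))
    (pairs : Fin k → Option (Fin 4 × Fin 4)) (src dst : Fin 4)
    (L : List (ℤ × Finset (Fin k) × ℕ × ℕ × ℕ × ℕ))
    (hcert : ∀ t : Fin k → Bool,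
      (L.map fun e => if e.2.1 ⊆ zeros t then e.1 else 0).sum = Wfun cx β μ X pairs src dst t)
    (hbase : ∀ e ∈ L, cT μ X pairs e.2.1 .ab = e.2.2.1 ∧ cT μ X pairs e.2.1 .ac = e.2.2.2.1 ∧
      cT μ X pairs e.2.1 .bc = e.2.2.2.2.1 ∧ cT μ X pairs e.2.1 .abc = e.2.2.2.2.2) :
    ∑ σ ∈ univ.filter (allowed μ : HubConfig p q r s → Prop),
        Wfun cx β μ X pairs src dst (tvec μ X pairs σ) =
      (L.map fun e => e.1 * ((e.2.2.1 : ℤ) ^ p * (e.2.2.2.1 : ℤ) ^ q * (e.2.2.2.2.1 : ℤ) ^ r *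
        (e.2.2.2.2.2 : ℤ) ^ s)).sum := by
  have h := sum_weight_eq_of_cert (allowed μ : HubConfig p q r s → Prop)
    (fun l σ => factOf (famPred μ X pairs l) σ) (Wfun cx β μ X pairs src dst)
    (L.map fun e => (e.1, e.2.1)) (by
      intro t
      rw [← hcert t, List.map_map]
      rfl)
  rw [show (fun σ : HubConfig p q r s => Wfun cx β μ X pairs src dst (tvec μ X pairs σ)) =
      fun σ => Wfun cx β μ X pairs src dst (fun l => decide (factOf (famPred μ X pairs l) σ))
    from rfl]
  rw [h, List.map_map]
  congr 1
  refine List.map_congr_left fun e he => ?_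
  simp only [Function.comp]
  rw [card_allowed_not_facts]
  obtain ⟨h1, h2, h3, h4⟩ := hbase e he
  rw [h1, h2, h3, h4]
  push_cast
  rfl

end PercRepro.StarGadgetGraph
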